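import Literature.AlgebraicGeometry.HodgeTheory.PolarizedLimitMixedHodgeStructureNilpotentOrbitRealClassesOfLowWeight
import Literature.AlgebraicGeometry.HodgeTheory.PolarizedLimitMixedHodgeStructureIntegralClassesWeightBound
import Literature.AlgebraicGeometry.HodgeTheory.PolarizedLimitMixedHodgeStructureRescaledLimit
import HarnessLib

/-!
# Cattani–Deligne–Kaplan, Theorem 2.5, for a one-variable nilpotent orbit: integral Hodge classes of bounded self-intersection
# near the puncture are finite in number, lie in `W_k`, are monodromy invariant, and are Hodge at every point

Topic `Literature/AlgebraicGeometry/HodgeTheory` (namespace `…HodgeTheory.PolarizedLimitMixedHodgeStructure`).  Theorems only; no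
definition, no instance, no named fact (D-0026 net debt `0`).  This file ASSEMBLES the story
`…SharpInvariantClasses` (CDK Prop. 3.10) → `…NilpotentOrbitRealClassesOfLowWeight` (the exact-case weight arguments, CDK 4.5 (i), 4.8,
4.9) → `Motives/HodgeStructureHodgeNormLattice` + `…IntegralClassesWeightBound` (the lattice, CDK 4.3, 4.6) → `…RescaledLimit` (the
compactness step, CDK 4.7).

PRINTED SOURCE, VERBATIM. E. Cattani, P. Deligne, A. Kaplan, *On the locus of Hodge classes*, J. Amer. Math. Soc. 8 (1995) 483–506,
p. 488: **Theorem 2.5.** «Assume `𝒱` of weight `0`. Given `K`, there is a constant `A₁` (depending on `K` and `𝒱`) such that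
(i) There are only finitely many `v ∈ V_ℤ` such that: `Q(v, v) ≤ K` and `v ∈ Φ⁰(z)` at some point `z` with `0 ≤ x_i ≤ 1` and
`inf(y_i) ≥ A₁`.  (ii) Any such `v` is in `W₀`, as well as in `F_v⁰` for some limiting Hodge filtration `F_v`.»; p. 491: «Theorem 2.5 is
really a statement about what happens when there is a sequence of points `z^α ∈ D*ʳ` tending to `0` in `Dʳ` and of `v_α ∈ V_ℤ` integral of
type `(0, 0)` and of bounded norm.»; p. 505, **4.9**, `d = 1`: «As `u(n)` is close to `Φ⁰` at `z(n)` and at `z(n) − iτ₁(n)θ¹`,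
its Hodge norm at both places is close to `Q(u(n), u(n))^{1/2}` and hence is bounded … Being bounded and integral, `u(n)` can take only
finitely many values.  Taking a subsequence … we find that `u` is in the corresponding `Φ⁰`. It is in `W₀` by 4.3. This proves (4.1.2),
while (4.1.4) [`T_j u = 0`] results from 4.7.»

WHAT IS FORMALIZED — the case `r = 1` (one variable) of Thm. 2.5 for the variation given by the NILPOTENT ORBIT `θ(z) = exp(zN)·F` of a
polarized limit mixed Hodge structure `L = (W, F, N, Q)` of weight `k` on a finite-dimensional `ℚ`-space `V` (`L.nilpotentOrbit z _`, a
polarized Hodge structure for `Im z > α`; estimates beyond `β ≥ α`), with an arbitrary INTEGRAL STRUCTURE `Λ ⊆ V` (a finitely generated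
subgroup, e.g. `V_ℤ`), Hodge classes of type `(p, k − p)` (weight `0`, type `(0,0)` in the source), and `|Q(u,u)| ≤ K`.  Because `T = exp N`
acts on `V` and every conclusion is `T`-invariant, NO restriction `0 ≤ Re z ≤ 1` is needed.
**Theorem** (`exists_threshold_integral_hodgeClasses`, CDK Thm. 2.5 for `r = 1`): given `K` there is `A₁` such that for every `u ∈ Λ` with
`|Q(u, u)| ≤ K` which is of type `(p, k−p)` at some point `θ(z)` with `Im z ≥ A₁`:
* (ii)  `u ∈ W_k` (`…IntegralClassesWeightBound`);
* (4.1.4) **`N u = 0`** — by contradiction: a sequence of offenders `u_n`, `Im z_n → ∞`, has `u_n ∈ W_k`, top classes `π̂_k(1 ⊗ u_n)` in a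
  finite set (CDK 4.6), hence constant along a subsequence, hence `N`-invariant by the compactness step (CDK 4.7, `…RescaledLimit`), hence
  `N u_n ∈ W_{k−3} ∩ F^{p−1}θ(z_n)` real, `= 0` (CDK 4.8, `…RealClassesOfLowWeight`);
* (ii′) `1 ⊗ u ∈ F^p` for the LIMIT Hodge filtration and `u` is of type `(p, k−p)` at EVERY point of the orbit («in `F_v⁰` for some
  limiting Hodge filtration»; here for all of them, `exp(zN) u = u`);
* (i)  the set of such `u` is FINITE — they are Hodge classes of ONE polarized Hodge structure `θ(i(α+1))` with `Q(u,u) ≤ K`, and the tree's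
  `HodgeStructure.Polarization.finite_mem_hodgeClasses_form_le` (Hodge classes of bounded norm in a lattice are finite) applies.

NOT HERE: several variables (`r > 1`: CDK §3–§4 induction on `d`, the `SL₂ʳ`-orbit theorem), the perturbation `Γ(s)` of a general period
map (2.3, 2.7 — the passage from `Φ` to `Φ_nil`), the approximate version Thm. 2.16, and the algebraicity consequences 1.1–1.5.

## References

* [CattaniDeligneKaplan1995] E. Cattani, P. Deligne, A. Kaplan, *On the locus of Hodge classes*, J. Amer. Math. Soc. 8 (1995)
  483–506: Thm. 2.5 (p. 488), 2.14 (p. 491), Prop. 4.3, 4.6, Prop. 4.7, Prop. 4.8, 4.9 (pp. 501–505).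
* [Schmid1973] W. Schmid, Invent. Math. 22 (1973): Thm. (6.6), Cor. (6.7') (cite only).
* [CattaniKaplanSchmid1987] E. Cattani, A. Kaplan, W. Schmid, LNM 1246 (1987): §3 Cor. (3.7).
* [CattaniKaplanSchmid1986] E. Cattani, A. Kaplan, W. Schmid, Ann. of Math. 123 (1986) (cite only).
-/

noncomputable section

open scoped TensorProduct ComplexOrder
open Filter Topology

namespace Literature.AlgebraicGeometry

open Module
open Motives Motives.MixedHodgeStructure Motives.HodgeStructure
open Motives.HodgeStructure (conj ofRat ofRat_apply conj_ofRat)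

universe u

variable {V : Type u} [AddCommGroup V] [Module ℚ V] [FiniteDimensional ℚ V] {k : ℤ}

namespace HodgeTheory

namespace PolarizedLimitMixedHodgeStructure

variable (L : PolarizedLimitMixedHodgeStructure V k)

/-! ## §1 `N u = 0`: the contradiction argument of CDK §4 at `d = 1` -/

/-- `N_ℂ (1 ⊗ u) = 1 ⊗ (N u)`. [folklore] -/
private theorem N_baseChange_ofRat (u : V) : L.N.baseChange ℂ (ofRat u) = ofRat (L.N u) := by
  rw [ofRat_apply, LinearMap.baseChange_tmul, ofRat_apply]

/-- **CDK Thm. 2.5 (ii) with (4.1.4), `r = 1`: given `K`, there is `A` such that every `u ∈ Λ` with `|Q(u,u)| ≤ K` which is of type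
`(p, k−p)` at some point `θ(z)` with `Im z ≥ A` lies in `W_k` and satisfies `N u = 0`.**  Proof by contradiction (CDK 2.19/4.1): a sequence
`(u_n, z_n)` of offenders with `Im z_n → ∞` has `u_n ∈ W_k` (Prop. 4.3), `‖1 ⊗ u_n‖_{θ(z_n)} = |Q(u_n,u_n)|^{1/2} ≤ √K`, top classes
`π̂_k(1 ⊗ u_n)` in a finite set (4.6) hence constant `= û` along a subsequence, `N û = 0` (Prop. 4.7), hence `N u_n = 0` (Prop. 4.8) —
contradiction. [cite: CattaniDeligneKaplan1995, Thm. 2.5 (p. 488), 2.19, 4.1 and Props. 4.3, 4.6–4.8, 4.9 (pp. 493, 499–505)]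
[cite: Schmid1973, Thm. (6.6) (cite only)] -/
theorem exists_forall_mem_W_and_N_eq_zero_of_ofRat_mem_nilpotentOrbit_piece (Λ : Submodule ℤ V) (hΛ : Λ.FG) (K : ℝ) (p : ℤ) :
    ∃ A : ℝ, L.normThreshold < A ∧ ∀ u ∈ Λ, |(L.Q u u : ℝ)| ≤ K → ∀ (z : ℂ) (hz : L.normThreshold < z.im), A ≤ z.im →
      ofRat u ∈ (L.nilpotentOrbit z (L.orbitThreshold_lt_im hz)).piece p (k - p) → u ∈ L.W k ∧ L.N u = 0 := by
  classical
  obtain ⟨A₁, hA₁, hW⟩ := L.exists_forall_mem_W_of_ofRat_mem_nilpotentOrbit_piece Λ hΛ K p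
  -- it suffices to find a threshold for `N u = 0`
  suffices h : ∃ A : ℝ, ∀ u ∈ Λ, |(L.Q u u : ℝ)| ≤ K → ∀ (z : ℂ) (hz : L.normThreshold < z.im), A ≤ z.im →
      ofRat u ∈ (L.nilpotentOrbit z (L.orbitThreshold_lt_im hz)).piece p (k - p) → L.N u = 0 by
    obtain ⟨A, hA⟩ := h
    refine ⟨max A₁ A, lt_of_lt_of_le hA₁ (le_max_left _ _), fun u hu hK z hz hAz hup => ?_⟩
    exact ⟨hW u hu hK z hz ((le_max_left _ _).trans hAz) hup, hA u hu hK z hz ((le_max_right _ _).trans hAz) hup⟩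
  by_contra hcon
  push Not at hcon
  -- a sequence of offenders `(u n, z n)` with `Im (z n) ≥ max A₁ n`
  choose u huΛ huK z hz hAz hup hNu using fun n : ℕ => hcon (max A₁ n)
  have huW : ∀ n, u n ∈ L.W k := fun n => hW (u n) (huΛ n) (huK n) (z n) (hz n) ((le_max_left _ _).trans (hAz n)) (hup n)
  have hlim : Tendsto (fun n => (z n).im) atTop atTop :=
    tendsto_atTop_mono (fun n => (le_max_right _ _).trans (hAz n)) tendsto_natCast_atTop_atTop
  have hC : ∀ n, (L.nilpotentOrbitPolarization (z n) (L.orbitThreshold_lt_im (hz n))).hodgeNorm (ofRat (u n)) ≤ Real.sqrt K :=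
    fun n => L.hodgeNorm_nilpotentOrbit_ofRat_le_sqrt_of_mem_piece _ (hup n) (huK n)
  -- the top classes `g n = π̂_k (1 ⊗ u n)` lie in a finite set: one value `û` is taken infinitely often
  set g : ℕ → ℂ ⊗[ℚ] V := fun n => L.deltaSplit.toMixedHodgeStructure.deligneEProj k (ofRat (u n)) with hg_def
  have hS := L.finite_image_deligneEProj_self_of_ofRat_mem_nilpotentOrbit_piece Λ hΛ K p
  set S := {x : ℂ ⊗[ℚ] V | ∃ u ∈ Λ, u ∈ L.W k ∧ |(L.Q u u : ℝ)| ≤ K ∧ (∃ (z : ℂ) (hz : L.normThreshold < z.im),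
      ofRat u ∈ (L.nilpotentOrbit z (L.orbitThreshold_lt_im hz)).piece p (k - p)) ∧
      L.deltaSplit.toMixedHodgeStructure.deligneEProj k (ofRat u) = x} with hS_def
  have hgS : ∀ n, g n ∈ S := fun n => ⟨u n, huΛ n, huW n, huK n, ⟨z n, hz n, hup n⟩, rfl⟩
  haveI : Finite S := hS.to_subtype
  obtain ⟨⟨û, hûS⟩, hinf⟩ := Finite.exists_infinite_fiber fun n : ℕ => (⟨g n, hgS n⟩ : S)
  have hinf' : Set.Infinite {n : ℕ | g n = û} := by
    have h := Set.infinite_coe_iff.1 hinf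
    refine Set.Infinite.mono (fun n hn => ?_) h
    simp only [Set.mem_preimage, Set.mem_singleton_iff, Subtype.mk.injEq] at hn
    exact hn
  obtain ⟨φ, hφ, hgφ⟩ := extraction_of_frequently_atTop (Nat.frequently_atTop_iff_infinite.2 hinf')
  -- the compactness step: `N û = 0`
  have hû : L.N.baseChange ℂ û = 0 :=
    (L.sl2_invariant_of_deligneEProj_eq_const (fun j => ofRat (u (φ j))) (fun j => z (φ j)) (fun j => hz (φ j))
      (hlim.comp hφ.tendsto_atTop) (fun j => hC (φ j)) (fun j => conj_ofRat _)
      (fun j => by rw [ofRat_apply]; exact Submodule.tmul_mem_baseChange_of_mem 1 (huW (φ j))) (fun j => hup (φ j))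
      (fun j => hgφ j)).1
  -- the weight argument: `N (u (φ 0)) = 0`, contradiction
  have h0 : L.N (u (φ 0)) = 0 :=
    (L.N_apply_eq_zero_and_forall_ofRat_mem_piece_of_N_deligneEProj_eq_zero (L.orbitThreshold_lt_im (hz (φ 0))) (huW (φ 0))
      (hup (φ 0)) (by rw [show L.deltaSplit.toMixedHodgeStructure.deligneEProj k (ofRat (u (φ 0))) = û from hgφ 0]; exact hû)).1
  exact hNu (φ 0) h0

/-! ## §2 Consequences of `N u = 0`: Hodge at every point, in `F^p` of the limit; finiteness (CDK Thm. 2.5 (i)) -/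

/-- **An `N`-invariant rational class which is of type `(p, k−p)` at one point of the orbit is of type `(p, k−p)` at every point, and
`1 ⊗ u ∈ F^p ∩ conj F^{k−p}` for the limit Hodge filtration** («in `F_v⁰` for some limiting Hodge filtration `F_v`»).
[cite: CattaniDeligneKaplan1995, Thm. 2.5 (ii) (p. 488) and 4.9 (p. 505)] -/
theorem forall_ofRat_mem_nilpotentOrbit_piece_of_N_eq_zero {u : V} (hN : L.N u = 0) {z : ℂ} (hz : L.orbitThreshold < z.im) {p : ℤ}
    (hup : ofRat u ∈ (L.nilpotentOrbit z hz).piece p (k - p)) :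
    (∀ (z' : ℂ) (hz' : L.orbitThreshold < z'.im), ofRat u ∈ (L.nilpotentOrbit z' hz').piece p (k - p)) ∧
      ofRat u ∈ L.F p ∧ conj (ofRat u) ∈ L.F (k - p) := by
  have hN' : L.N.baseChange ℂ (ofRat u) = 0 := by rw [L.N_baseChange_ofRat, hN, map_zero]
  exact ⟨fun z' hz' => L.mem_nilpotentOrbit_piece_of_N_apply_eq_zero_of_mem_nilpotentOrbit_piece hz hz' hN' hup,
    (L.mem_nilpotentOrbit_piece_iff_of_N_apply_eq_zero hz (show p + (k - p) = k by omega) hN').1 hup⟩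

/-- **`Q(u, u) ≥ 0` for a rational class of type `(p, k−p)` at a point of the orbit** («for `u` a real element of type `(0, 0)`,
`h(u, u) = Q(u, u)`», `h` the positive definite Hodge form): for `p + p = k` this is the positivity of the polarization on Hodge classes
(the tree's `Polarization.form_self_pos_of_mem_hodgeClasses`), for `p + p ≠ k` the class vanishes.  Hence the printed hypothesis
`Q(u,u) ≤ K` and `|Q(u,u)| ≤ K` are interchangeable. [cite: CattaniDeligneKaplan1995, §1 (p. 484) and Thm. 2.5 (p. 488)] -/
theorem Q_self_nonneg_of_ofRat_mem_nilpotentOrbit_piece {u : V} {z : ℂ} (hz : L.orbitThreshold < z.im) {p : ℤ}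
    (hup : ofRat u ∈ (L.nilpotentOrbit z hz).piece p (k - p)) : 0 ≤ L.Q u u := by
  by_cases hu0 : u = 0
  · simp [hu0]
  by_cases hpk : p + p = k
  · have hF : u ∈ (L.nilpotentOrbit z hz).hodgeClasses p := by
      rw [HodgeStructure.mem_hodgeClasses_iff]
      exact (((L.nilpotentOrbit z hz).mem_piece_iff (show p + (k - p) = k by omega)).1 hup).1
    have h := (L.nilpotentOrbitPolarization z hz).form_self_pos_of_mem_hodgeClasses hpk hF hu0
    rw [L.nilpotentOrbitPolarization_form] at h
    exact h.le
  · exfalso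
    have h0 : ofRat u = 0 :=
      (L.nilpotentOrbit z hz).eq_zero_of_conj_eq_of_mem_piece_of_ne (show p ≠ k - p by omega) (conj_ofRat u) hup
    exact hu0 (HodgeStructure.ofRat_injective (h0.trans (map_zero _).symm))

/-- At a point where `u` is of type `(p, k−p)`: `Q(u,u) ≤ K → |Q(u,u)| ≤ K`. [cite: CattaniDeligneKaplan1995, §1 (p. 484)] -/
theorem abs_Q_self_le_of_Q_self_le_of_ofRat_mem_nilpotentOrbit_piece {u : V} {z : ℂ} (hz : L.orbitThreshold < z.im) {p : ℤ}
    (hup : ofRat u ∈ (L.nilpotentOrbit z hz).piece p (k - p)) {K : ℝ} (hK : (L.Q u u : ℝ) ≤ K) : |(L.Q u u : ℝ)| ≤ K := by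
  rwa [abs_of_nonneg (by exact_mod_cast L.Q_self_nonneg_of_ofRat_mem_nilpotentOrbit_piece hz hup)]

/-- `|Q(u,u)| ≤ K` implies `Q(u,u) ≤ ⌈K⌉` over `ℚ`. [folklore] -/
private theorem Q_le_ceil_of_abs_le {u : V} {K : ℝ} (hK : |(L.Q u u : ℝ)| ≤ K) : L.Q u u ≤ (⌈K⌉ : ℚ) := by
  have h1 : (L.Q u u : ℝ) ≤ K := (le_abs_self _).trans hK
  have h2 : (L.Q u u : ℝ) ≤ ((⌈K⌉ : ℤ) : ℝ) := h1.trans (Int.le_ceil K)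
  have h3 : (L.Q u u : ℚ) ≤ ((⌈K⌉ : ℤ) : ℚ) := by exact_mod_cast h2
  exact h3

/-- **CDK Thm. 2.5 (i), `r = 1`: the `N`-invariant integral Hodge classes of bounded self-intersection are finite in number** — the
`u ∈ Λ` with `N u = 0`, `|Q(u,u)| ≤ K`, of type `(p, k−p)` at some point of the orbit, are Hodge classes of ONE polarized Hodge structure
`θ(z₀)` with `Q(u,u) ≤ ⌈K⌉`, and Hodge classes of bounded norm in a lattice are finite (the tree's `finite_mem_hodgeClasses_form_le`).
«Being bounded and integral, `u(n)` can take only finitely many values.» [cite: CattaniDeligneKaplan1995, Thm. 2.5 (i) (p. 488) and 4.9 (p. 505)] -/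
theorem finite_setOf_N_eq_zero_of_ofRat_mem_nilpotentOrbit_piece (Λ : Submodule ℤ V) (hΛ : Λ.FG) (K : ℝ) (p : ℤ) :
    {u : V | u ∈ Λ ∧ L.N u = 0 ∧ |(L.Q u u : ℝ)| ≤ K ∧
      ∃ (z : ℂ) (hz : L.orbitThreshold < z.im), ofRat u ∈ (L.nilpotentOrbit z hz).piece p (k - p)}.Finite := by
  -- a fixed point of the orbit
  set z₀ : ℂ := ((L.orbitThreshold + 1 : ℝ) : ℂ) * Complex.I with hz₀_def
  have hz₀ : L.orbitThreshold < z₀.im := by rw [hz₀_def, Complex.mul_I_im, Complex.ofReal_re]; linarith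
  by_cases hpk : p + p = k
  · have hfin := (L.nilpotentOrbitPolarization z₀ hz₀).finite_mem_hodgeClasses_form_le hpk Λ hΛ (⌈K⌉ : ℚ)
    refine hfin.subset ?_
    rintro u ⟨huΛ, hN, hK, z, hz, hup⟩
    obtain ⟨hall, -, -⟩ := L.forall_ofRat_mem_nilpotentOrbit_piece_of_N_eq_zero hN hz hup
    refine ⟨huΛ, ?_, ?_⟩
    · rw [HodgeStructure.mem_hodgeClasses_iff]
      have h := hall z₀ hz₀
      rw [show k - p = p by omega] at h
      exact ((L.nilpotentOrbit z₀ hz₀).mem_piece_iff hpk).1 h |>.1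
    · rw [L.nilpotentOrbitPolarization_form]
      exact L.Q_le_ceil_of_abs_le hK
  · -- off the middle only `u = 0` is a real class of type `(p, k−p)`
    refine (Set.finite_singleton (0 : V)).subset ?_
    rintro u ⟨-, -, -, z, hz, hup⟩
    have h0 : ofRat u = 0 :=
      (L.nilpotentOrbit z hz).eq_zero_of_conj_eq_of_mem_piece_of_ne (show p ≠ k - p by omega) (conj_ofRat u) hup
    exact HodgeStructure.ofRat_injective (h0.trans (map_zero _).symm)

/-! ## §3 The theorem -/

/-- **CDK Thm. 2.5 for `r = 1`, with the two-sided bound `|Q(u,u)| ≤ K`** (equivalent to the printed `Q(u,u) ≤ K` by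
`Q_self_nonneg_of_ofRat_mem_nilpotentOrbit_piece`; the printed form is `exists_threshold_integral_hodgeClasses` below).
[cite: CattaniDeligneKaplan1995, Thm. 2.5 (p. 488), (4.1.1)–(4.1.4) and 4.9 (pp. 499–505)] -/
theorem exists_threshold_integral_hodgeClasses_of_abs_le (Λ : Submodule ℤ V) (hΛ : Λ.FG) (K : ℝ) (p : ℤ) :
    ∃ A₁ : ℝ, L.normThreshold < A₁ ∧
      (∀ u ∈ Λ, |(L.Q u u : ℝ)| ≤ K → ∀ (z : ℂ) (hz : L.normThreshold < z.im), A₁ ≤ z.im →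
        ofRat u ∈ (L.nilpotentOrbit z (L.orbitThreshold_lt_im hz)).piece p (k - p) →
          u ∈ L.W k ∧ L.N u = 0 ∧ ofRat u ∈ L.F p ∧
            ∀ (z' : ℂ) (hz' : L.orbitThreshold < z'.im), ofRat u ∈ (L.nilpotentOrbit z' hz').piece p (k - p)) ∧
      {u : V | u ∈ Λ ∧ |(L.Q u u : ℝ)| ≤ K ∧ ∃ (z : ℂ) (hz : L.normThreshold < z.im), A₁ ≤ z.im ∧
        ofRat u ∈ (L.nilpotentOrbit z (L.orbitThreshold_lt_im hz)).piece p (k - p)}.Finite := by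
  obtain ⟨A, hA, h⟩ := L.exists_forall_mem_W_and_N_eq_zero_of_ofRat_mem_nilpotentOrbit_piece Λ hΛ K p
  refine ⟨A, hA, fun u hu hK z hz hAz hup => ?_, ?_⟩
  · obtain ⟨huW, hN⟩ := h u hu hK z hz hAz hup
    obtain ⟨hall, hF, -⟩ := L.forall_ofRat_mem_nilpotentOrbit_piece_of_N_eq_zero hN (L.orbitThreshold_lt_im hz) hup
    exact ⟨huW, hN, hF, hall⟩
  · refine (L.finite_setOf_N_eq_zero_of_ofRat_mem_nilpotentOrbit_piece Λ hΛ K p).subset ?_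
    rintro u ⟨hu, hK, z, hz, hAz, hup⟩
    exact ⟨hu, (h u hu hK z hz hAz hup).2, hK, z, L.orbitThreshold_lt_im hz, hup⟩

/-- **Cattani–Deligne–Kaplan, Theorem 2.5, for the one-variable nilpotent orbit.**  Let `L = (W, F, N, Q)` be a polarized limit mixed
Hodge structure of weight `k` on the finite-dimensional `ℚ`-space `V`, `θ(z) = exp(zN)·F` its nilpotent orbit (a polarized Hodge structure
for `Im z > α`), `Λ ⊆ V` a finitely generated subgroup (the integral structure), `p ∈ ℤ` and `K ∈ ℝ`.  There is a constant `A₁`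
(depending on `K`, `Λ` and `L`) such that, for every `u ∈ Λ` with `Q(u, u) ≤ K` which is of type `(p, k−p)` at SOME point `θ(z)` with
`Im z ≥ A₁`:
**(ii) `u ∈ W_k`; `N u = 0`; `1 ⊗ u ∈ F^p` for the limiting Hodge filtration and `u` is of type `(p, k−p)` at EVERY point of the orbit;
and (i) the set of all such `u` is finite.**  (Source: weight `0`, type `(0,0)`, `v ∈ V_ℤ`, `Q(v,v) ≤ K`, points with `0 ≤ x ≤ 1`,
`y ≥ A₁`; «any such `v` is in `W₀`, as well as in `F_v⁰` for some limiting Hodge filtration»; `T₁ u = 0` is (4.1.4).)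
[cite: CattaniDeligneKaplan1995, Thm. 2.5 (p. 488), (4.1.1)–(4.1.4) and 4.9 (pp. 499–505)] [cite: Schmid1973, Thm. (6.6), Cor. (6.7') (cite only)]
[cite: CattaniKaplanSchmid1987, §3 Cor. (3.7)] -/
theorem exists_threshold_integral_hodgeClasses (Λ : Submodule ℤ V) (hΛ : Λ.FG) (K : ℝ) (p : ℤ) :
    ∃ A₁ : ℝ, L.normThreshold < A₁ ∧
      (∀ u ∈ Λ, (L.Q u u : ℝ) ≤ K → ∀ (z : ℂ) (hz : L.normThreshold < z.im), A₁ ≤ z.im →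
        ofRat u ∈ (L.nilpotentOrbit z (L.orbitThreshold_lt_im hz)).piece p (k - p) →
          u ∈ L.W k ∧ L.N u = 0 ∧ ofRat u ∈ L.F p ∧
            ∀ (z' : ℂ) (hz' : L.orbitThreshold < z'.im), ofRat u ∈ (L.nilpotentOrbit z' hz').piece p (k - p)) ∧
      {u : V | u ∈ Λ ∧ (L.Q u u : ℝ) ≤ K ∧ ∃ (z : ℂ) (hz : L.normThreshold < z.im), A₁ ≤ z.im ∧
        ofRat u ∈ (L.nilpotentOrbit z (L.orbitThreshold_lt_im hz)).piece p (k - p)}.Finite := by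
  obtain ⟨A₁, hA₁, h, hfin⟩ := L.exists_threshold_integral_hodgeClasses_of_abs_le Λ hΛ K p
  refine ⟨A₁, hA₁, fun u hu hK z hz hAz hup =>
    h u hu (L.abs_Q_self_le_of_Q_self_le_of_ofRat_mem_nilpotentOrbit_piece _ hup hK) z hz hAz hup, hfin.subset ?_⟩
  rintro u ⟨hu, hK, z, hz, hAz, hup⟩
  exact ⟨hu, L.abs_Q_self_le_of_Q_self_le_of_ofRat_mem_nilpotentOrbit_piece _ hup hK, z, hz, hAz, hup⟩

/-- **The sequence form** («Theorem 2.5 is really a statement about what happens when there is a sequence of points `z^α` tending to `0` …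
and of `v_α ∈ V_ℤ` integral of type `(0,0)` and of bounded norm»): if `u_n ∈ Λ`, `Q(u_n, u_n) ≤ K`, and `u_n` is of type `(p, k−p)`
at `θ(z_n)` with `Im z_n → ∞`, then for all large `n`: `u_n ∈ W_k`, `N u_n = 0`, `1 ⊗ u_n ∈ F^p`, and the `u_n` (for large `n`) range
in a finite set. [cite: CattaniDeligneKaplan1995, Thm. 2.5 and 2.14 (pp. 488, 491)] -/
theorem eventually_mem_W_and_N_eq_zero_of_seq (Λ : Submodule ℤ V) (hΛ : Λ.FG) (K : ℝ) (p : ℤ) (u : ℕ → V) (z : ℕ → ℂ)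
    (hz : ∀ n, L.normThreshold < (z n).im) (hlim : Tendsto (fun n => (z n).im) atTop atTop) (hu : ∀ n, u n ∈ Λ)
    (hK : ∀ n, (L.Q (u n) (u n) : ℝ) ≤ K)
    (hup : ∀ n, ofRat (u n) ∈ (L.nilpotentOrbit (z n) (L.orbitThreshold_lt_im (hz n))).piece p (k - p)) :
    (∀ᶠ n in atTop, u n ∈ L.W k ∧ L.N (u n) = 0 ∧ ofRat (u n) ∈ L.F p) ∧
      ∃ s : Set V, s.Finite ∧ ∀ᶠ n in atTop, u n ∈ s := by
  obtain ⟨A₁, hA₁, h, hfin⟩ := L.exists_threshold_integral_hodgeClasses Λ hΛ K p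
  have hev : ∀ᶠ n in atTop, A₁ ≤ (z n).im := hlim.eventually (eventually_ge_atTop A₁)
  refine ⟨hev.mono fun n hn => ?_, ⟨_, hfin, hev.mono fun n hn => ⟨hu n, hK n, z n, hz n, hn, hup n⟩⟩⟩
  obtain ⟨hW, hN, hF, -⟩ := h (u n) (hu n) (hK n) (z n) (hz n) hn (hup n)
  exact ⟨hW, hN, hF⟩

end PolarizedLimitMixedHodgeStructure

end HodgeTheory

end Literature.AlgebraicGeometry

end
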